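import Summits.Ventures.HodgeRepro2.T5SU11BorelHaarMeasure
import Summits.Ventures.HodgeRepro2.T5SU11IwasawaMeasure

/-!
# The Haar measure of the Borel subgroup `B = N A` in the chart `n_s a_t`: `db = e^{-2t} ds dt`; `B = A × N` as measure spaces

`T5SU11BorelHaar` transports the Lebesgue measure `ds dt` of the chart `ζ = s + i t ↦ a_t n_s` to the
left Haar measure `borelHaar` of `B`. In the OTHER order `n_s a_t = a_t n_{e^{-2t} s}`
(`T5SU11BorelSubgroup.unip_mul_hyp`), the chart `borelCoordNA ζ = n_s a_t` is the `A N` chart composed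
with the exponential shear `(s, t) ↦ (e^{-2t} s, t)` (`shear (-2)`, Jacobian `e^{-2t}`,
`det_shearDeriv`), so `borelHaar = (borelCoordNA)_* (e^{-2t} ds dt) = (borelCoordNA)_* iwasawaDensity`
(`borelHaar_eq_map_NA`; `map_shear_volume`: the shear carries `e^{ct} ds dt` to `ds dt`) — the same
density `e^{-2t}` as in the Iwasawa formula `dg = e^{-2t} ds dt dk` of `T5SU11IwasawaHaar`, of which
this is the `B`-part. Both charts are measurable embeddings, hence the integral formulae
`∫_B f = ∫_ℂ f(a_t n_s) ds dt` (`integral_borelHaar_AN`) and `∫_B f = ∫_ℂ e^{-2t} f(n_s a_t) ds dt`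
(`integral_borelHaar_NA`, `lintegral_borelHaar_NA`) hold for EVERY `f`, with no integrability
hypothesis. Finally, through `ℂ ≅ ℝ × ℝ`, `borelHaar` is the push-forward of the product Lebesgue
measure `ds ⊗ dt` under `(s, t) ↦ a_t n_s` (`borelHaar_eq_map_prod`) — the left Haar measure of the
semidirect product `B = A ⋉ N` is the product of the Haar measures `dt` of `A` and `ds` of `N` —
with the iterated form `∫_B f = ∫_ℝ ∫_ℝ f(a_t n_s) dt ds` for integrable `f`
(`integral_borelHaar_iterated`). Nothing is claimed about (N).

Blind lane: Mathlib + the HodgeRepro2 prefix only; no sorry; axioms ⊆ {propext, Classical.choice,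
Quot.sound}.
-/

namespace Summit.Ventures.HodgeRepro2.T5SU11BorelHaarNA

open MeasureTheory MeasureTheory.Measure Metric Filter Topology Set Complex
open T5UnitaryBound T5PoincareDensity T5PoincareInvariance T5PoincareMeasure T5SU11Unimodular
  T5SU11Fibration T5SU11FibrationHaar T5SU11Cartan T5SU11OneParameter T5BergmanCoefficient
  T5SU11HyperbolicSubgroup T5SU11UnipotentSubgroup T5SU11BorelSubgroup T5SU11Iwasawa
  T5SU11IwasawaUnique T5SU11BorelTransitive T5SU11IwasawaHaar T5SU11BorelHaar
  T5SU11BorelHaarMeasure T5SU11IwasawaMeasure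
open scoped ENNReal NNReal

/-! ### The exponential shears `(s, t) ↦ (e^{c t} s, t)` of `ℂ = ℝ²` -/

/-- The shear `(s, t) ↦ (e^{c t} s, t)` of `ℂ = ℝ²`. -/
noncomputable def shear (c : ℝ) (ζ : ℂ) : ℂ := ⟨Real.exp (c * ζ.im) * ζ.re, ζ.im⟩

/-- `Re (shear c ζ) = e^{c Im ζ} Re ζ`. -/
lemma shear_re (c : ℝ) (ζ : ℂ) : (shear c ζ).re = Real.exp (c * ζ.im) * ζ.re := rfl

/-- `Im (shear c ζ) = Im ζ`. -/
lemma shear_im (c : ℝ) (ζ : ℂ) : (shear c ζ).im = ζ.im := rfl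

/-- `shear c ζ = e^{c Im ζ} Re ζ + (Im ζ) i`. -/
lemma shear_eq (c : ℝ) (ζ : ℂ) :
    shear c ζ = ((Real.exp (c * ζ.im) * ζ.re : ℝ) : ℂ) + (ζ.im : ℂ) * I := by
  apply Complex.ext
  · simp only [shear, Complex.add_re, Complex.ofReal_re, Complex.mul_re, Complex.ofReal_im,
      Complex.I_re, Complex.I_im]
    ring
  · simp only [shear, Complex.add_im, Complex.ofReal_im, Complex.mul_im, Complex.ofReal_re,
      Complex.I_re, Complex.I_im]
    ring

/-- `shear c ∘ shear (-c) = id`. -/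
lemma shear_shear (c : ℝ) (ζ : ℂ) : shear c (shear (-c) ζ) = ζ := by
  apply Complex.ext
  · simp only [shear]
    rw [← mul_assoc, ← Real.exp_add, show c * ζ.im + -c * ζ.im = 0 by ring, Real.exp_zero, one_mul]
  · rfl

/-- `shear (-c) ∘ shear c = id`. -/
lemma shear_neg_shear (c : ℝ) (ζ : ℂ) : shear (-c) (shear c ζ) = ζ := by
  apply Complex.ext
  · simp only [shear]
    rw [← mul_assoc, ← Real.exp_add, show -c * ζ.im + c * ζ.im = 0 by ring, Real.exp_zero, one_mul]
  · rfl

/-- `shear c` is a bijection (inverse `shear (-c)`). -/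
theorem shear_bijective (c : ℝ) : Function.Bijective (shear c) :=
  Function.bijective_iff_has_inverse.2 ⟨shear (-c), shear_neg_shear c, shear_shear c⟩

/-- The real derivative of `shear c` at `ζ`: `η ↦ (e^{c Im ζ} Re η + c e^{c Im ζ} Re ζ Im η) + (Im η) i`. -/
noncomputable def shearDeriv (c : ℝ) (ζ : ℂ) : ℂ →L[ℝ] ℂ :=
  Complex.ofRealCLM.comp (Real.exp (c * ζ.im) • Complex.reCLM +
    ζ.re • (Real.exp (c * ζ.im) • (c • Complex.imCLM))) + I • Complex.ofRealCLM.comp Complex.imCLM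

/-- `shearDeriv c ζ` applied to `η`. -/
lemma shearDeriv_apply (c : ℝ) (ζ η : ℂ) :
    shearDeriv c ζ η =
      ((Real.exp (c * ζ.im) * η.re + ζ.re * (Real.exp (c * ζ.im) * (c * η.im)) : ℝ) : ℂ) +
        I * (η.im : ℂ) := by
  simp only [shearDeriv, _root_.add_apply, ContinuousLinearMap.comp_apply, _root_.smul_apply,
    Complex.ofRealCLM_apply, Complex.reCLM_apply, Complex.imCLM_apply, smul_eq_mul]

/-- `shear c` is real-differentiable with derivative `shearDeriv c ζ`. -/
lemma hasFDerivAt_shear (c : ℝ) (ζ : ℂ) : HasFDerivAt (shear c) (shearDeriv c ζ) ζ := by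
  have e : shear c = fun ζ => ((Real.exp (c * ζ.im) * ζ.re : ℝ) : ℂ) + (ζ.im : ℂ) * I :=
    funext (shear_eq c)
  rw [e]
  have hg : HasFDerivAt (fun ζ : ℂ => c * ζ.im) (c • Complex.imCLM) ζ :=
    Complex.imCLM.hasFDerivAt.const_mul c
  have he : HasFDerivAt (fun ζ : ℂ => Real.exp (c * ζ.im))
      (Real.exp (c * ζ.im) • (c • Complex.imCLM)) ζ :=
    (Real.hasDerivAt_exp _).comp_hasFDerivAt ζ hg
  have hm : HasFDerivAt (fun ζ : ℂ => Real.exp (c * ζ.im) * ζ.re)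
      (Real.exp (c * ζ.im) • Complex.reCLM + ζ.re • (Real.exp (c * ζ.im) • (c • Complex.imCLM))) ζ :=
    he.mul Complex.reCLM.hasFDerivAt
  have h1 : HasFDerivAt (fun ζ : ℂ => ((Real.exp (c * ζ.im) * ζ.re : ℝ) : ℂ))
      (Complex.ofRealCLM.comp (Real.exp (c * ζ.im) • Complex.reCLM +
        ζ.re • (Real.exp (c * ζ.im) • (c • Complex.imCLM)))) ζ :=
    Complex.ofRealCLM.hasFDerivAt.comp ζ hm
  have h2 : HasFDerivAt (fun ζ : ℂ => (ζ.im : ℂ) * I) (I • Complex.ofRealCLM.comp Complex.imCLM) ζ :=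
    (Complex.ofRealCLM.hasFDerivAt.comp ζ Complex.imCLM.hasFDerivAt).mul_const I
  exact h1.add h2

/-- **The Jacobian of `shear c` is `e^{c Im ζ}`.** -/
theorem det_shearDeriv (c : ℝ) (ζ : ℂ) : (shearDeriv c ζ).det = Real.exp (c * ζ.im) := by
  show LinearMap.det ((shearDeriv c ζ : ℂ →L[ℝ] ℂ) : ℂ →ₗ[ℝ] ℂ) = _
  rw [← LinearMap.det_toMatrix Complex.basisOneI, Matrix.det_fin_two]
  simp only [LinearMap.toMatrix_apply, ContinuousLinearMap.coe_coe, Complex.coe_basisOneI,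
    Complex.coe_basisOneI_repr, shearDeriv_apply, Matrix.cons_val_zero, Matrix.cons_val_one,
    Complex.one_re, Complex.one_im, Complex.I_re, Complex.I_im, Complex.add_re, Complex.add_im,
    Complex.ofReal_re, Complex.ofReal_im, Complex.mul_re, Complex.mul_im]
  ring

/-- `shear c` is continuous. -/
lemma continuous_shear (c : ℝ) : Continuous (shear c) :=
  continuous_iff_continuousAt.2 fun ζ => (hasFDerivAt_shear c ζ).continuousAt

/-- `shear c` is measurable. -/
lemma measurable_shear (c : ℝ) : Measurable (shear c) := (continuous_shear c).measurable

/-- `shear c` as a homeomorphism of `ℂ` (inverse `shear (-c)`). -/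
noncomputable def shearHomeomorph (c : ℝ) : ℂ ≃ₜ ℂ where
  toFun := shear c
  invFun := shear (-c)
  left_inv := shear_neg_shear c
  right_inv := shear_shear c
  continuous_toFun := continuous_shear c
  continuous_invFun := continuous_shear (-c)

/-- `shear c` is a measurable embedding. -/
lemma measurableEmbedding_shear (c : ℝ) : MeasurableEmbedding (shear c) :=
  (shearHomeomorph c).measurableEmbedding

/-- **The shear carries `e^{c t} ds dt` to `ds dt`**: `(shear c)_* (e^{c Im ζ} dζ) = dζ`. -/
theorem map_shear_volume (c : ℝ) :
    Measure.map (shear c) (volume.withDensity fun ζ => ENNReal.ofReal (Real.exp (c * ζ.im))) =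
      volume := by
  have h := map_withDensity_abs_det_fderiv_eq_addHaar (volume : Measure ℂ)
    MeasurableSet.univ.nullMeasurableSet
    (fun ζ _ => (hasFDerivAt_shear c ζ).hasFDerivWithinAt) (shear_bijective c).1.injOn
  simp only [det_shearDeriv, abs_of_pos (Real.exp_pos _), Measure.restrict_univ, Set.image_univ,
    (shear_bijective c).2.range_eq] at h
  exact h

/-- The case `c = -2`: `(shear (-2))_* iwasawaDensity = volume`, `iwasawaDensity = e^{-2t} ds dt`. -/
theorem map_shear_iwasawaDensity : Measure.map (shear (-2)) iwasawaDensity = volume := by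
  have h := map_shear_volume (-2)
  have e : (fun ζ : ℂ => ENNReal.ofReal (Real.exp (-2 * ζ.im))) =
      fun ζ => ENNReal.ofReal (Real.exp (-(2 * ζ.im))) := by
    funext ζ
    rw [neg_mul]
  rw [e] at h
  exact h

/-! ### The `N A` chart `ζ = s + i t ↦ n_s a_t` of `B` -/

/-- The `N A` chart of the Borel subgroup: `ζ = s + i t ↦ n_s a_t`. -/
noncomputable def borelCoordNA (ζ : ℂ) : SU11 := unip ζ.re * hyp ζ.im

/-- **`n_s a_t = a_t n_{e^{-2t} s}`**: the `N A` chart is the `A N` chart composed with `shear (-2)`. -/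
theorem borelCoordNA_eq (ζ : ℂ) : borelCoordNA ζ = borelCoord (shear (-2) ζ) := by
  unfold borelCoordNA borelCoord
  rw [shear_re, shear_im, unip_mul_hyp, neg_mul]

/-- `n_s a_t ∈ B`. -/
lemma borelCoordNA_mem (ζ : ℂ) : borelCoordNA ζ ∈ borelSubgroup := by
  rw [borelCoordNA_eq]
  exact borelCoord_mem _

/-- The `N A` chart is injective. -/
theorem borelCoordNA_injective : Function.Injective borelCoordNA := by
  intro ζ ζ' h
  rw [borelCoordNA_eq, borelCoordNA_eq] at h
  exact (shear_bijective (-2)).1 (borelCoord_injective h)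

/-- The `N A` chart is onto `B`. -/
theorem borelCoordNA_surjOn : ∀ g ∈ borelSubgroup, ∃ ζ : ℂ, borelCoordNA ζ = g := by
  intro g hg
  obtain ⟨ζ, hζ⟩ := borelCoord_surjOn g hg
  exact ⟨shear 2 ζ, by rw [borelCoordNA_eq, shear_neg_shear, hζ]⟩

/-- The `N A` chart as a map into the subgroup `B`. -/
noncomputable def borelCoordNAB (ζ : ℂ) : borelSubgroup := ⟨borelCoordNA ζ, borelCoordNA_mem ζ⟩

/-- `borelCoordNAB = borelCoordB ∘ shear (-2)`. -/
lemma borelCoordNAB_eq_comp : borelCoordNAB = borelCoordB ∘ shear (-2) :=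
  funext fun ζ => Subtype.ext (borelCoordNA_eq ζ)

/-- The `N A` chart is a measurable embedding `ℂ → B`. -/
lemma measurableEmbedding_borelCoordNAB : MeasurableEmbedding borelCoordNAB := by
  rw [borelCoordNAB_eq_comp]
  exact measurableEmbedding_borelCoordB.comp (measurableEmbedding_shear _)

/-- `borelCoordNAB` is measurable. -/
lemma measurable_borelCoordNAB : Measurable borelCoordNAB :=
  measurableEmbedding_borelCoordNAB.measurable

/-! ### The Haar measure of `B` in the `N A` chart: `db = e^{-2t} ds dt` -/

/-- **`borelHaar = (n_s a_t)_* (e^{-2t} ds dt)`**: in the chart `ζ = s + i t ↦ n_s a_t`, the left Haar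
measure of `B` is `e^{-2t} ds dt = iwasawaDensity`. -/
theorem borelHaar_eq_map_NA : borelHaar = Measure.map borelCoordNAB iwasawaDensity := by
  rw [borelCoordNAB_eq_comp, ← Measure.map_map measurable_borelCoordB (measurable_shear _),
    map_shear_iwasawaDensity]
  rfl

/-- **`∫_B f = ∫_ℂ f(a_t n_s) ds dt`** for EVERY `f` (the `A N` chart is a measurable embedding). -/
theorem integral_borelHaar_AN {E : Type*} [NormedAddCommGroup E] [NormedSpace ℝ E]
    (f : borelSubgroup → E) : ∫ b, f b ∂borelHaar = ∫ ζ, f (borelCoordB ζ) :=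
  measurableEmbedding_borelCoordB.integral_map f

/-- **`∫⁻_B f = ∫⁻_ℂ e^{-2t} f(n_s a_t) ds dt`** for EVERY `f`. -/
theorem lintegral_borelHaar_NA (f : borelSubgroup → ℝ≥0∞) :
    ∫⁻ b, f b ∂borelHaar =
      ∫⁻ ζ, ENNReal.ofReal (Real.exp (-(2 * ζ.im))) * f (borelCoordNAB ζ) := by
  rw [borelHaar_eq_map_NA, measurableEmbedding_borelCoordNAB.lintegral_map, iwasawaDensity,
    lintegral_withDensity_eq_lintegral_mul_non_measurable _ measurable_iwasawaDensityFun
      (ae_of_all _ fun ζ => ENNReal.ofReal_lt_top)]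
  rfl

/-- **`∫_B f = ∫_ℂ e^{-2t} f(n_s a_t) ds dt`** for EVERY `f` (no integrability hypothesis). -/
theorem integral_borelHaar_NA {E : Type*} [NormedAddCommGroup E] [NormedSpace ℝ E]
    (f : borelSubgroup → E) :
    ∫ b, f b ∂borelHaar = ∫ ζ, Real.exp (-(2 * ζ.im)) • f (borelCoordNAB ζ) := by
  rw [borelHaar_eq_map_NA, measurableEmbedding_borelCoordNAB.integral_map, iwasawaDensity,
    integral_withDensity_eq_integral_toReal_smul measurable_iwasawaDensityFun
      (ae_of_all _ fun ζ => ENNReal.ofReal_lt_top)]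
  congr 1
  funext ζ
  rw [ENNReal.toReal_ofReal (Real.exp_pos _).le]

/-! ### `B = A × N` as measure spaces: `borelHaar = (a_t n_s)_* (ds ⊗ dt)` -/

/-- `(s, t) ↦ a_t n_s ∈ B` on `ℝ × ℝ`. -/
noncomputable def mulAN (p : ℝ × ℝ) : borelSubgroup := borelCoordB ⟨p.1, p.2⟩

/-- `mulAN = borelCoordB ∘ (ℝ × ℝ ≅ ℂ)`. -/
lemma mulAN_eq_comp : mulAN = borelCoordB ∘ Complex.measurableEquivRealProd.symm :=
  funext fun p => by rw [Function.comp_apply, Complex.measurableEquivRealProd_symm_apply]; rfl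

/-- `mulAN` is a measurable embedding `ℝ × ℝ → B`. -/
lemma measurableEmbedding_mulAN : MeasurableEmbedding mulAN := by
  rw [mulAN_eq_comp]
  exact measurableEmbedding_borelCoordB.comp Complex.measurableEquivRealProd.symm.measurableEmbedding

/-- **`borelHaar = (a_t n_s)_* (ds ⊗ dt)`**: the left Haar measure of `B = A ⋉ N` is the push-forward
of the product of the Lebesgue measures of the parameters `s` (of `N`) and `t` (of `A`). -/
theorem borelHaar_eq_map_prod : borelHaar = Measure.map mulAN (volume : Measure (ℝ × ℝ)) := by
  have h : (volume : Measure ℂ) = Measure.map Complex.measurableEquivRealProd.symm volume :=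
    Complex.volume_preserving_equiv_real_prod.symm.map_eq.symm
  show Measure.map borelCoordB volume = _
  rw [h, Measure.map_map measurable_borelCoordB Complex.measurableEquivRealProd.symm.measurable,
    mulAN_eq_comp]

/-- **`∫_B f = ∫_{ℝ × ℝ} f(a_t n_s) d(s, t)`** for EVERY `f`. -/
theorem integral_borelHaar_prod {E : Type*} [NormedAddCommGroup E] [NormedSpace ℝ E]
    (f : borelSubgroup → E) : ∫ b, f b ∂borelHaar = ∫ p : ℝ × ℝ, f (mulAN p) := by
  rw [borelHaar_eq_map_prod, measurableEmbedding_mulAN.integral_map]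

/-- **`∫_B f = ∫_ℝ ∫_ℝ f(a_t n_s) dt ds`** for `borelHaar`-integrable `f` (Fubini). -/
theorem integral_borelHaar_iterated {E : Type*} [NormedAddCommGroup E] [NormedSpace ℝ E]
    [CompleteSpace E] (f : borelSubgroup → E) (hf : Integrable f borelHaar) :
    ∫ b, f b ∂borelHaar = ∫ s : ℝ, ∫ t : ℝ, f (mulAN (s, t)) := by
  rw [integral_borelHaar_prod]
  have hf' : Integrable (f ∘ mulAN) (volume : Measure (ℝ × ℝ)) := by
    rw [← measurableEmbedding_mulAN.integrable_map_iff, ← borelHaar_eq_map_prod]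
    exact hf
  exact integral_prod (fun p : ℝ × ℝ => f (mulAN p)) hf'

end Summit.Ventures.HodgeRepro2.T5SU11BorelHaarNA
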